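import Summits.QuantumFields.YangMills.Theorems.LuscherReductionDressedRitzPolyakovLiftSlabTruncUniversality
import Summits.QuantumFields.YangMills.Theorems.LuscherReductionDressedRitzLiftLeakageSlab
import HarnessLib

/-!
# Route `LuscherReduction`, crux `DressedRitz` (stmt-QuantumFields-20205), line «polyakovlift» r5 — NEGATIVE lane (census):
# the finite-slab currencies of S-UNIV′ and S-LEAK are EQUIVALENT to the Euclidean currencies — no new attack surface, no new content

Negative-side census lemmas of the standing disprover (seat `ym-cdisprove-20205-1`, GEN 5).  Since GEN 4 the LEAD and seat s1 restated the two hard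
stubs of the line in FINITE-SLAB currency: `SlabChannelUniversalityAt k` (p540780, slab ratios `slabCorr … M` with the vacuum constants `c_i = ⟨φ, G_iφ⟩`),
`SlabTruncChannelUniversalityAt k` (p548518, truncated slab ratios `slabTrunc … M`, no vacuum data at all) and `LiftLeak.SlabLeakageAt k` (p547059), each
with the forward implication «slab (∀ M ≥ M₀) ⟹ Euclidean» by `M → ∞` (`tendsto_slabCorr`, `tendsto_slabTrunc`).  This file records the CONVERSES, so that
the slab texts are literally equivalent to `EuclideanChannelUniversalityAt k` ∕ `LiftLeak.EuclideanLeakageAt k` (hence, by p538125 ∕ p540608, to the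
registered r5 stubs `Stmt.stub_universality` ∕ `Stmt.stub_liftLeakage`):

* §1 ABSTRACT PASSAGE BACK (`eventually_univClauses_of_limit`, `eventually_leakClause_of_limit`): if the (E5)∕(E6′) resp. (E4) clauses hold for the
  LIMIT tables with constants `(E, D)` and all diagonal limit correlators at separations `2m`, `2m+1` are positive, then for ANY larger constants
  `E' > E`, `D' > D` the same clauses hold for every approximating sequence of tables from some `M₀` on (`Tendsto.eventually_lt`; the positivity makes
  every right-hand side strictly monotone in the constant).
* §2 THE CONVERSES (★ `slabTruncChannelUniversality_of_euclidean`, ★ `slabChannelUniversality_of_euclidean`, ★ `slabLeakage_of_euclidean`; constants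
  `C ↦ C + 1`, same `lam0`, `L0 ↦ max L0 1`) and the equivalences `slabTruncChannelUniversalityAt_iff`, `slabChannelUniversalityAt_iff`,
  `slabLeakageAt_iff`.  Positivity inputs: (o0) for every lift basis on both sides (`liftBasis_dressed_o0`, `shadowFamily_o0`) and Lüscher's strict
  positivity of the transfer matrix for the odd separation (`qform_su2Rep_pos`).
* §3 SIGN STRUCTURE AT FINITE `M` (`slabTrunc_even_diag_nonneg`): the truncated slab autocorrelation at even separation is a Cauchy–Schwarz defect,
  `slabTrunc β G (2s) i i M ≥ 0` for EVERY `M` — there is no finite-`M` sign to exploit against `SlabTruncChannelUniversalityAt`.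

CENSUS READING (prose).  The slab restatements change the FORMAT a constructive small-field expansion would consume (finite-volume path integrals on
`L³ × T`, uniformly in `T ≥ T₀`), not the CONTENT: every hazard and every verdict recorded for the Euclidean texts in `Cruxes/DressedRitz/Disproof.lean`
((G2-b) one-loop saturation of (E5), (G3-a′)/(G4) the NEAR∕FAR leakage split of (E4), the (E6′) amplitude reading of `DressedCrossPair`) transfers verbatim to
the slab texts, and conversely a refutation of a slab text would be a refutation of the registered stub.  In particular the uniformity «∀ M ≥ M₀» is
automatic (it costs exactly `C ↦ C + 1`) and carries no information about the `T → ∞` rate.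

HONEST FRAMING: elementary limit bookkeeping on a fixed lattice (conditional femto rung R2b1); nothing here bears on infinite volume, the continuum limit or
the Clay gap.  References: E. Seiler, LNP 159 (1982) §3 [cite: SeilerLNP1982, §3]; M. Lüscher, U. Wolff, NPB 339 (1990) 222 [cite: LuscherWolff1990, §2].
-/

set_option autoImplicit false

noncomputable section

open MeasureTheory Filter Topology Real
open Literature.MathematicalPhysics.QuantumFieldTheory (GaugeConfig Site gaugeTransform)
open scoped BigOperators

namespace Summit.QuantumFields.YangMills.Theorems.FemtoTransferGap.PolyakovLift.Negative

open Summit.QuantumFields.YangMills.Theorems.FemtoTransferGap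
open Summit.QuantumFields.YangMills.Theorems.FemtoTransferGap.PolyakovLift
open Summit.QuantumFields.YangMills.Theorems.FemtoTransferGap.LiftLeak

/-! ## §1 Abstract passage from limit clauses back to eventual clauses with enlarged constants -/

section Abstract

variable {k m : ℕ}

/-- **(E5)∕(E6′) at the limit ⟹ (E5)∕(E6′) eventually, for any larger constants.**  `F, O`: limit tables; `sF, sO`: approximants converging entrywise;
all diagonal limits at separations `2m`, `2m+1` positive. [cite: SeilerLNP1982, §3] -/
theorem eventually_univClauses_of_limit {E E' D D' : ℝ} (hE : E < E') (hD : D < D')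
    {F O : ℕ → Fin k → Fin k → ℝ} {sF sO : ℕ → Fin k → Fin k → ℕ → ℝ}
    (TF : ∀ t i l, Tendsto (sF t i l) atTop (𝓝 (F t i l))) (TO : ∀ t i l, Tendsto (sO t i l) atTop (𝓝 (O t i l)))
    (hF0 : ∀ i, 0 < F (2 * m) i i) (hO0 : ∀ i, 0 < O (2 * m) i i) (hF1 : ∀ i, 0 < F (2 * m + 1) i i) (hO1 : ∀ i, 0 < O (2 * m + 1) i i)
    (h5 : ∀ i : Fin k,
      F (2 * m + 1) i i * O (2 * m) i i ≤ E * (O (2 * m + 1) i i * F (2 * m) i i) ∧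
        O (2 * m + 1) i i * F (2 * m) i i ≤ E * (F (2 * m + 1) i i * O (2 * m) i i))
    (h6 : ∀ i l : Fin k, i ≠ l →
      |(F (2 * m + 1) i l - (F (2 * m + 1) i i / F (2 * m) i i + F (2 * m + 1) l l / F (2 * m) l l) / 2 * F (2 * m) i l) *
            (Real.sqrt (O (2 * m) i i) * Real.sqrt (O (2 * m) l l)) -
          (O (2 * m + 1) i l - (O (2 * m + 1) i i / O (2 * m) i i + O (2 * m + 1) l l / O (2 * m) l l) / 2 * O (2 * m) i l) *
            (Real.sqrt (F (2 * m) i i) * Real.sqrt (F (2 * m) l l))|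
        ≤ D * (Real.sqrt (F (2 * m) i i) * Real.sqrt (F (2 * m) l l)) * (Real.sqrt (O (2 * m) i i) * Real.sqrt (O (2 * m) l l))) :
    ∀ᶠ M in atTop,
      (∀ i : Fin k,
        sF (2 * m + 1) i i M * sO (2 * m) i i M ≤ E' * (sO (2 * m + 1) i i M * sF (2 * m) i i M) ∧
          sO (2 * m + 1) i i M * sF (2 * m) i i M ≤ E' * (sF (2 * m + 1) i i M * sO (2 * m) i i M)) ∧
      (∀ i l : Fin k, i ≠ l →
        |(sF (2 * m + 1) i l M - (sF (2 * m + 1) i i M / sF (2 * m) i i M + sF (2 * m + 1) l l M / sF (2 * m) l l M) / 2 * sF (2 * m) i l M) *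
              (Real.sqrt (sO (2 * m) i i M) * Real.sqrt (sO (2 * m) l l M)) -
            (sO (2 * m + 1) i l M - (sO (2 * m + 1) i i M / sO (2 * m) i i M + sO (2 * m + 1) l l M / sO (2 * m) l l M) / 2 * sO (2 * m) i l M) *
              (Real.sqrt (sF (2 * m) i i M) * Real.sqrt (sF (2 * m) l l M))|
          ≤ D' * (Real.sqrt (sF (2 * m) i i M) * Real.sqrt (sF (2 * m) l l M)) *
              (Real.sqrt (sO (2 * m) i i M) * Real.sqrt (sO (2 * m) l l M))) := by
  refine (eventually_all.2 fun i => (?_ : ∀ᶠ M in atTop, _ ∧ _)).and (eventually_all.2 fun i => eventually_all.2 fun l => ?_)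
  · -- (E5) at channel `i`: both right-hand sides are positive, so the limit inequalities are strict with `E'`
    have hpos1 : 0 < O (2 * m + 1) i i * F (2 * m) i i := mul_pos (hO1 i) (hF0 i)
    have hpos2 : 0 < F (2 * m + 1) i i * O (2 * m) i i := mul_pos (hF1 i) (hO0 i)
    have hlt1 : F (2 * m + 1) i i * O (2 * m) i i < E' * (O (2 * m + 1) i i * F (2 * m) i i) :=
      (h5 i).1.trans_lt (mul_lt_mul_of_pos_right hE hpos1)
    have hlt2 : O (2 * m + 1) i i * F (2 * m) i i < E' * (F (2 * m + 1) i i * O (2 * m) i i) :=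
      (h5 i).2.trans_lt (mul_lt_mul_of_pos_right hE hpos2)
    have e1 := ((TF _ i i).mul (TO _ i i)).eventually_lt (((TO _ i i).mul (TF _ i i)).const_mul E') hlt1
    have e2 := ((TO _ i i).mul (TF _ i i)).eventually_lt (((TF _ i i).mul (TO _ i i)).const_mul E') hlt2
    exact (e1.and e2).mono fun M hM => ⟨hM.1.le, hM.2.le⟩
  · -- (E6′) at the pair `(i, l)`
    by_cases hil : i = l
    · exact Eventually.of_forall fun M h => absurd hil h
    · have hP : 0 < (Real.sqrt (F (2 * m) i i) * Real.sqrt (F (2 * m) l l)) * (Real.sqrt (O (2 * m) i i) * Real.sqrt (O (2 * m) l l)) :=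
        mul_pos (mul_pos (Real.sqrt_pos.2 (hF0 i)) (Real.sqrt_pos.2 (hF0 l)))
          (mul_pos (Real.sqrt_pos.2 (hO0 i)) (Real.sqrt_pos.2 (hO0 l)))
      have hlt : |(F (2 * m + 1) i l - (F (2 * m + 1) i i / F (2 * m) i i + F (2 * m + 1) l l / F (2 * m) l l) / 2 * F (2 * m) i l) *
              (Real.sqrt (O (2 * m) i i) * Real.sqrt (O (2 * m) l l)) -
            (O (2 * m + 1) i l - (O (2 * m + 1) i i / O (2 * m) i i + O (2 * m + 1) l l / O (2 * m) l l) / 2 * O (2 * m) i l) *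
              (Real.sqrt (F (2 * m) i i) * Real.sqrt (F (2 * m) l l))| <
          D' * (Real.sqrt (F (2 * m) i i) * Real.sqrt (F (2 * m) l l)) * (Real.sqrt (O (2 * m) i i) * Real.sqrt (O (2 * m) l l)) := by
        refine (h6 i l hil).trans_lt ?_
        rw [mul_assoc D, mul_assoc D']
        exact mul_lt_mul_of_pos_right hD hP
      have TsF : Tendsto (fun M => Real.sqrt (sF (2 * m) i i M) * Real.sqrt (sF (2 * m) l l M)) atTop
          (𝓝 (Real.sqrt (F (2 * m) i i) * Real.sqrt (F (2 * m) l l))) := (TF _ i i).sqrt.mul (TF _ l l).sqrt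
      have TsO : Tendsto (fun M => Real.sqrt (sO (2 * m) i i M) * Real.sqrt (sO (2 * m) l l M)) atTop
          (𝓝 (Real.sqrt (O (2 * m) i i) * Real.sqrt (O (2 * m) l l))) := (TO _ i i).sqrt.mul (TO _ l l).sqrt
      have TAF : Tendsto (fun M => sF (2 * m + 1) i l M -
            (sF (2 * m + 1) i i M / sF (2 * m) i i M + sF (2 * m + 1) l l M / sF (2 * m) l l M) / 2 * sF (2 * m) i l M) atTop
          (𝓝 (F (2 * m + 1) i l - (F (2 * m + 1) i i / F (2 * m) i i + F (2 * m + 1) l l / F (2 * m) l l) / 2 * F (2 * m) i l)) :=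
        (TF _ i l).sub ((((TF _ i i).div (TF _ i i) (hF0 i).ne').add ((TF _ l l).div (TF _ l l) (hF0 l).ne')).div_const 2 |>.mul
          (TF _ i l))
      have TAO : Tendsto (fun M => sO (2 * m + 1) i l M -
            (sO (2 * m + 1) i i M / sO (2 * m) i i M + sO (2 * m + 1) l l M / sO (2 * m) l l M) / 2 * sO (2 * m) i l M) atTop
          (𝓝 (O (2 * m + 1) i l - (O (2 * m + 1) i i / O (2 * m) i i + O (2 * m + 1) l l / O (2 * m) l l) / 2 * O (2 * m) i l)) :=
        (TO _ i l).sub ((((TO _ i i).div (TO _ i i) (hO0 i).ne').add ((TO _ l l).div (TO _ l l) (hO0 l).ne')).div_const 2 |>.mul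
          (TO _ i l))
      have e := (((TAF.mul TsO).sub (TAO.mul TsF)).abs).eventually_lt (((TsF.const_mul D').mul TsO)) hlt
      exact e.mono fun M hM _ => hM.le

/-- **(E4) at the limit ⟹ (E4) eventually, for any larger constant** (diagonal limit at separation `2m` positive). [cite: SeilerLNP1982, §3] -/
theorem eventually_leakClause_of_limit {D D' : ℝ} (hD : D < D') {F : ℕ → Fin k → Fin k → ℝ} {sF : ℕ → Fin k → Fin k → ℕ → ℝ}
    (TF : ∀ t i, Tendsto (sF t i i) atTop (𝓝 (F t i i))) (hF0 : ∀ i, 0 < F (2 * m) i i)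
    (h4 : ∀ i : Fin k, F (2 * m + 2) i i * F (2 * m) i i - F (2 * m + 1) i i ^ 2 ≤ D * F (2 * m) i i ^ 2) :
    ∀ᶠ M in atTop, ∀ i : Fin k,
      sF (2 * m + 2) i i M * sF (2 * m) i i M - sF (2 * m + 1) i i M ^ 2 ≤ D' * sF (2 * m) i i M ^ 2 := by
  refine eventually_all.2 fun i => ?_
  have hlt : F (2 * m + 2) i i * F (2 * m) i i - F (2 * m + 1) i i ^ 2 < D' * F (2 * m) i i ^ 2 :=
    (h4 i).trans_lt (mul_lt_mul_of_pos_right hD (pow_pos (hF0 i) 2))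
  have e := (((TF _ i).mul (TF _ i)).sub ((TF _ i).pow 2)).eventually_lt (((TF _ i).pow 2).const_mul D') hlt
  exact e.mono fun M hM => hM.le

end Abstract

/-! ## §2 ★ The converses: Euclidean ⟹ slab (constant `C + 1`) -/

section Converses

variable {k : ℕ}

/-- Shared positivity ∕ limit package at a window point, FINE side: `corr(2m)_{ii} > 0`, `corr(2m+1)_{ii} > 0` for the flowed-Polyakov insertions of any lift
basis at `B₁ > 0` over a raw vacuum ((o0) dressed, then Lüscher's strict positivity for the odd separation). [cite: Luscher1977, §3] -/
theorem corr_diag_pos {L : ℕ} [NeZero L] {β : ℝ} (hβ : 0 < β) {φ : GaugeConfig 3 L SU2 → ℝ} (hφ : IsRawVacuum β φ) {B₁ : ℝ} (hB₁ : 0 < B₁)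
    {ω : GaugeConfig 3 1 SU2 → ℝ} {g : Fin k → (GaugeConfig 3 1 SU2 → ℝ)} (hbasis : LiftBasis B₁ k ω g) (t : ℝ) (m : ℕ) (i : Fin k) :
    0 < corr β φ (fun i => flowLiftAt (L := L) 0 t (g i)) (2 * m) i i ∧ 0 < corr β φ (fun i => flowLiftAt (L := L) 0 t (g i)) (2 * m + 1) i i := by
  have hGi : ∀ i, IsPhys (flowLiftAt (L := L) 0 t (g i)) := fun i => isPhys_flowLiftAt 0 _ (hbasis.2.2.2.2.1 i)
  have hl0 : 0 < levelValue su2Rep L β 0 := levelValue_su2Rep_pos hβ 0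
  have h0 := liftBasis_dressed_o0 hβ hφ hB₁ hbasis 0 t m i
  have hu : IsPhys ((transferApply β)^[m] (OpPlat.ins φ (flowLiftAt (L := L) 0 t (g i)))) :=
    isPhys_iterate_transferApply β (OpPlat.isPhys_ins hφ.1 (hGi i)) m
  have h1 := qform_su2Rep_pos hβ hu h0
  rw [qform_eq_l2_transferApply, corr_dressed_form hβ hφ.1 hGi m i i] at h1
  rw [corr_dressed_norm hβ hφ.1 hGi m i i] at h0
  exact ⟨pos_of_mul_pos_right h0 (pow_nonneg hl0.le _), pos_of_mul_pos_right h1 (pow_nonneg hl0.le _)⟩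

/-- Shared positivity package, ONE-SITE side: `corr(2·dressSteps L)_{ii} > 0`, `corr(2·dressSteps L + 1)_{ii} > 0` for the shadow insertions
`g_i ∘ powLink L` at `B > 0` over a one-site raw vacuum, any lift basis at `B' > 0`, `L ≥ 1`. [cite: Luscher1977, §3] -/
theorem corr_shadow_diag_pos {B B' : ℝ} (hB : 0 < B) (hB' : 0 < B') {L : ℕ} (hL : 0 < L) {e₀ : GaugeConfig 3 1 SU2 → ℝ}
    (he₀ : IsRawVacuum (L := 1) B e₀) {ω : GaugeConfig 3 1 SU2 → ℝ} {g : Fin k → (GaugeConfig 3 1 SU2 → ℝ)} (hbasis : LiftBasis B' k ω g)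
    (i : Fin k) :
    0 < corr B e₀ (fun i => g i ∘ powLink L) (2 * dressSteps L) i i ∧ 0 < corr B e₀ (fun i => g i ∘ powLink L) (2 * dressSteps L + 1) i i := by
  have hSi : ∀ i, IsPhys (g i ∘ powLink L) := fun i => isPhys_comp_powLink L (hbasis.2.2.2.2.1 i)
  have hm0 : 0 < levelValue su2Rep 1 B 0 := levelValue_su2Rep_pos (L := 1) hB 0
  have h0 := shadowFamily_o0 hB hB' hL he₀ hbasis i
  simp only [shadowFamily, shadowVec] at h0
  have hu : IsPhys ((transferApply B)^[dressSteps L] (OpPlat.ins e₀ (g i ∘ powLink L))) :=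
    isPhys_iterate_transferApply B (OpPlat.isPhys_ins he₀.1 (hSi i)) _
  have h1 := qform_su2Rep_pos hB hu h0
  rw [qform_eq_l2_transferApply, corr_dressed_form hB he₀.1 hSi (dressSteps L) i i] at h1
  rw [corr_dressed_norm hB he₀.1 hSi (dressSteps L) i i] at h0
  exact ⟨pos_of_mul_pos_right h0 (pow_nonneg hm0.le _), pos_of_mul_pos_right h1 (pow_nonneg hm0.le _)⟩

/-- The two enlarged constants are larger: `e^{CΛ²/L} < e^{(C+1)Λ²/L}` and `C·(Λ²/L) < (C+1)·(Λ²/L)` for `Λ > 0`, `L ≥ 1`. [folklore] -/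
theorem constants_lt {C Λ : ℝ} {L : ℕ} (hΛ : 0 < Λ) (hL : (0 : ℝ) < L) :
    Real.exp (C * Λ ^ 2 / L) < Real.exp ((C + 1) * Λ ^ 2 / L) ∧ C * (Λ ^ 2 / L) < (C + 1) * (Λ ^ 2 / L) :=
  ⟨Real.exp_lt_exp.2 (div_lt_div_of_pos_right (mul_lt_mul_of_pos_right (lt_add_one C) (pow_pos hΛ 2)) hL),
    mul_lt_mul_of_pos_right (lt_add_one C) (div_pos (pow_pos hΛ 2) hL)⟩

/-- ★ **`EuclideanChannelUniversalityAt k → SlabTruncChannelUniversalityAt k`** (constant `C + 1`, same `lam0`). [cite: SeilerLNP1982, §3] [cite: LuscherWolff1990, §2] -/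
theorem slabTruncChannelUniversality_of_euclidean (h : EuclideanChannelUniversalityAt k) : SlabTruncChannelUniversalityAt k := by
  obtain ⟨C, lam0, hC, hlam0, hk⟩ := h
  refine ⟨C + 1, lam0, by linarith, hlam0, fun lam hlam hle => ?_⟩
  obtain ⟨L0, hL⟩ := hk lam hlam hle
  refine ⟨max L0 1, fun L _ hL0 β hW φ hφ ω g hbasis e₀ he₀ => ?_⟩
  have hcl := hL L ((le_max_left _ _).trans hL0) β hW φ hφ ω g hbasis e₀ he₀
  have hLpos : 0 < L := lt_of_lt_of_le zero_lt_one ((le_max_right _ _).trans hL0)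
  have hβ : 0 < β := zero_lt_one.trans_le hW.1
  have hΛpos : 0 < luscherLambda β L := luscherLambda_pos_of_window hlam hW
  have hLr : (0 : ℝ) < L := Nat.cast_pos.mpr hLpos
  have hBpos : 0 < oneSiteCoupling β L := by
    unfold oneSiteCoupling; exact div_pos (mul_pos two_pos (pow_pos hLr 3)) (pow_pos hΛpos 3)
  have hB1pos : 0 < liftCoupling β L := by
    unfold liftCoupling; exact div_pos two_pos (pow_pos hΛpos 3)
  set m := dressSteps L with hm
  set G : Fin k → (GaugeConfig 3 L SU2 → ℝ) := fun i => flowLiftAt (L := L) 0 (flowTime β L) (g i) with hG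
  set S : Fin k → (GaugeConfig 3 1 SU2 → ℝ) := fun i => g i ∘ powLink L with hS
  have hGi : ∀ i, IsPhys (G i) := fun i => isPhys_flowLiftAt 0 _ (hbasis.2.2.2.2.1 i)
  have hSi : ∀ i, IsPhys (S i) := fun i => isPhys_comp_powLink L (hbasis.2.2.2.2.1 i)
  have TF : ∀ (t : ℕ) (i l : Fin k), Tendsto (slabTrunc β G t i l) atTop (𝓝 (corr β φ G t i l)) :=
    fun t i l => tendsto_slabTrunc hβ hφ hGi t i l
  have TO : ∀ (t : ℕ) (i l : Fin k), Tendsto (slabTrunc (oneSiteCoupling β L) S t i l) atTop (𝓝 (corr (oneSiteCoupling β L) e₀ S t i l)) :=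
    fun t i l => tendsto_slabTrunc hBpos he₀ hSi t i l
  have hF := fun i => corr_diag_pos hβ hφ hB1pos hbasis (flowTime β L) m i
  have hO : ∀ i, 0 < corr (oneSiteCoupling β L) e₀ S (2 * m) i i ∧ 0 < corr (oneSiteCoupling β L) e₀ S (2 * m + 1) i i :=
    fun i => corr_shadow_diag_pos hBpos hB1pos hLpos he₀ hbasis i
  obtain ⟨hE, hD⟩ := constants_lt (C := C) hΛpos hLr
  obtain ⟨h5, h6⟩ := hcl
  exact Filter.eventually_atTop.1 (eventually_univClauses_of_limit hE hD TF TO (fun i => (hF i).1) (fun i => (hO i).1)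
    (fun i => (hF i).2) (fun i => (hO i).2) h5 h6)

/-- ★ **`EuclideanChannelUniversalityAt k → SlabChannelUniversalityAt k`** (constant `C + 1`, same `lam0`). [cite: SeilerLNP1982, §3] [cite: LuscherWolff1990, §2] -/
theorem slabChannelUniversality_of_euclidean (h : EuclideanChannelUniversalityAt k) : SlabChannelUniversalityAt k := by
  obtain ⟨C, lam0, hC, hlam0, hk⟩ := h
  refine ⟨C + 1, lam0, by linarith, hlam0, fun lam hlam hle => ?_⟩
  obtain ⟨L0, hL⟩ := hk lam hlam hle
  refine ⟨max L0 1, fun L _ hL0 β hW φ hφ ω g hbasis e₀ he₀ => ?_⟩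
  have hcl := hL L ((le_max_left _ _).trans hL0) β hW φ hφ ω g hbasis e₀ he₀
  have hLpos : 0 < L := lt_of_lt_of_le zero_lt_one ((le_max_right _ _).trans hL0)
  have hβ : 0 < β := zero_lt_one.trans_le hW.1
  have hΛpos : 0 < luscherLambda β L := luscherLambda_pos_of_window hlam hW
  have hLr : (0 : ℝ) < L := Nat.cast_pos.mpr hLpos
  have hBpos : 0 < oneSiteCoupling β L := by
    unfold oneSiteCoupling; exact div_pos (mul_pos two_pos (pow_pos hLr 3)) (pow_pos hΛpos 3)
  have hB1pos : 0 < liftCoupling β L := by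
    unfold liftCoupling; exact div_pos two_pos (pow_pos hΛpos 3)
  set m := dressSteps L with hm
  set G : Fin k → (GaugeConfig 3 L SU2 → ℝ) := fun i => flowLiftAt (L := L) 0 (flowTime β L) (g i) with hG
  set S : Fin k → (GaugeConfig 3 1 SU2 → ℝ) := fun i => g i ∘ powLink L with hS
  have hGi : ∀ i, IsPhys (G i) := fun i => isPhys_flowLiftAt 0 _ (hbasis.2.2.2.2.1 i)
  have hSi : ∀ i, IsPhys (S i) := fun i => isPhys_comp_powLink L (hbasis.2.2.2.2.1 i)
  have TF : ∀ (t : ℕ) (i l : Fin k), Tendsto (slabCorr β φ G t i l) atTop (𝓝 (corr β φ G t i l)) :=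
    fun t i l => tendsto_slabCorr hβ.le hφ hGi t i l
  have TO : ∀ (t : ℕ) (i l : Fin k), Tendsto (slabCorr (oneSiteCoupling β L) e₀ S t i l) atTop (𝓝 (corr (oneSiteCoupling β L) e₀ S t i l)) :=
    fun t i l => tendsto_slabCorr hBpos.le he₀ hSi t i l
  have hF := fun i => corr_diag_pos hβ hφ hB1pos hbasis (flowTime β L) m i
  have hO : ∀ i, 0 < corr (oneSiteCoupling β L) e₀ S (2 * m) i i ∧ 0 < corr (oneSiteCoupling β L) e₀ S (2 * m + 1) i i :=
    fun i => corr_shadow_diag_pos hBpos hB1pos hLpos he₀ hbasis i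
  obtain ⟨hE, hD⟩ := constants_lt (C := C) hΛpos hLr
  obtain ⟨h5, h6⟩ := hcl
  exact Filter.eventually_atTop.1 (eventually_univClauses_of_limit hE hD TF TO (fun i => (hF i).1) (fun i => (hO i).1)
    (fun i => (hF i).2) (fun i => (hO i).2) h5 h6)

/-- ★ **`EuclideanLeakageAt k → SlabLeakageAt k`** (constant `C + 1`, same `lam0`, same `L0`). [cite: SeilerLNP1982, §3] [cite: LuscherWolff1990, §2] -/
theorem slabLeakage_of_euclidean (h : EuclideanLeakageAt k) : SlabLeakageAt k := by
  obtain ⟨C, lam0, hC, hlam0, hk⟩ := h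
  refine ⟨C + 1, lam0, by linarith, hlam0, fun lam hlam hle => ?_⟩
  obtain ⟨L0, hL⟩ := hk lam hlam hle
  refine ⟨L0, fun L _ hL0 β hW φ hφ ω g hbasis => ?_⟩
  have hcl := hL L hL0 β hW φ hφ ω g hbasis
  have hβ : 0 < β := zero_lt_one.trans_le hW.1
  have hΛpos : 0 < luscherLambda β L := luscherLambda_pos_of_window hlam hW
  have hLr : (0 : ℝ) < L := Nat.cast_pos.mpr (Nat.pos_of_ne_zero (NeZero.ne L))
  have hB1pos : 0 < liftCoupling β L := by
    unfold liftCoupling; exact div_pos two_pos (pow_pos hΛpos 3)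
  set m := dressSteps L with hm
  set G : Fin k → (GaugeConfig 3 L SU2 → ℝ) := fun i => flowLiftAt (L := L) 0 (flowTime β L) (g i) with hG
  have hGi : ∀ i, IsPhys (G i) := fun i => isPhys_flowLiftAt 0 _ (hbasis.2.2.2.2.1 i)
  have TF : ∀ (t : ℕ) (i : Fin k), Tendsto (slabCorr β φ G t i i) atTop (𝓝 (corr β φ G t i i)) :=
    fun t i => tendsto_slabCorr hβ.le hφ hGi t i i
  have hF0 : ∀ i, 0 < corr β φ G (2 * m) i i := fun i => (corr_diag_pos hβ hφ hB1pos hbasis (flowTime β L) m i).1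
  have hD : C * (luscherLambda β L ^ 3 / (L : ℝ) ^ 2) < (C + 1) * (luscherLambda β L ^ 3 / (L : ℝ) ^ 2) :=
    mul_lt_mul_of_pos_right (lt_add_one C) (div_pos (pow_pos hΛpos 3) (pow_pos hLr 2))
  exact Filter.eventually_atTop.1 (eventually_leakClause_of_limit hD TF hF0 hcl)

/-- `SlabTruncChannelUniversalityAt k ↔ EuclideanChannelUniversalityAt k`. [cite: SeilerLNP1982, §3] -/
theorem slabTruncChannelUniversalityAt_iff : SlabTruncChannelUniversalityAt k ↔ EuclideanChannelUniversalityAt k :=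
  ⟨euclideanChannelUniversality_of_slabTrunc, slabTruncChannelUniversality_of_euclidean⟩

/-- `SlabChannelUniversalityAt k ↔ EuclideanChannelUniversalityAt k`. [cite: SeilerLNP1982, §3] -/
theorem slabChannelUniversalityAt_iff : SlabChannelUniversalityAt k ↔ EuclideanChannelUniversalityAt k :=
  ⟨euclideanChannelUniversality_of_slab, slabChannelUniversality_of_euclidean⟩

/-- `SlabLeakageAt k ↔ EuclideanLeakageAt k`. [cite: SeilerLNP1982, §3] -/
theorem slabLeakageAt_iff : SlabLeakageAt k ↔ EuclideanLeakageAt k :=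
  ⟨euclideanLeakage_of_slab, slabLeakage_of_euclidean⟩

/-- The three slab texts at every level are equivalent to the channel form `ChannelUniversalityAt` being reachable from the Euclidean one and to the
registered r5 text of `Stmt.stub_liftLeakage` (`liftLeakage_iff_euclidean`). [cite: LuscherWolff1990, §2] -/
theorem slabLeakage_all_iff_liftLeakage :
    (∀ k : ℕ, SlabLeakageAt k) ↔
      ∀ k : ℕ, ∃ C lam0 : ℝ, 0 ≤ C ∧ 0 < lam0 ∧ ∀ lam : ℝ, 0 < lam → lam ≤ lam0 → ∃ L0 : ℕ,
        ∀ (L : ℕ) [NeZero L], L0 ≤ L → ∀ β : ℝ, InFemtoWindow lam β L →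
          ∀ φ : GaugeConfig 3 L SU2 → ℝ, IsRawVacuum β φ →
            ∀ (ω : GaugeConfig 3 1 SU2 → ℝ) (g : Fin k → (GaugeConfig 3 1 SU2 → ℝ)), LiftBasis (liftCoupling β L) k ω g →
              LeakageClause k C β (dressedLiftFamily β φ g) :=
  (forall_congr' fun _ => slabLeakageAt_iff).trans liftLeakage_iff_euclidean

end Converses

/-! ## §3 Sign structure of the truncated slab autocorrelation at finite `M` -/

section Sign

variable {N : ℕ} [NeZero N] {k : ℕ}

/-- **`slabTrunc β G (2s) i i M ≥ 0` for every `M`**: with `Φ = slabGround β M`, `a = K_β^[s](G_iΦ)`, `b = K_β^[s]Φ`, the truncated slab autocorrelation at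
even separation is `(‖a‖²‖b‖² − ⟨a,b⟩²)/‖b‖⁴ ≥ 0` (Cauchy–Schwarz; the vacuum-free truncation is a variance, not a signed quantity). [cite: SeilerLNP1982, §3] -/
theorem slabTrunc_even_diag_nonneg (β : ℝ) {G : Fin k → (GaugeConfig 3 N SU2 → ℝ)} (hG : ∀ i, IsPhys (G i)) (s : ℕ) (i : Fin k) (M : ℕ) :
    0 ≤ slabTrunc β G (2 * s) i i M := by
  have hΦ : IsPhys (slabGround (L := N) β M) := isPhys_slabGround β M
  have hGΦ : IsPhys (G i * slabGround (L := N) β M) := OpPlat.isPhys_mul (hG i) hΦ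
  have h1Φ : (fun _ : GaugeConfig 3 N SU2 => (1 : ℝ)) * slabGround (L := N) β M = slabGround β M := by funext U; simp
  have hss : s + s = 2 * s := by ring
  -- the three entries as Gram numbers of `a = K^s(G_iΦ)`, `b = K^sΦ`
  set a := (transferApply (L := N) β)^[s] (G i * slabGround β M) with ha
  set b := (transferApply (L := N) β)^[s] (slabGround β M) with hb
  have haP : IsPhys a := isPhys_iterate_transferApply β hGΦ s
  have hbP : IsPhys b := isPhys_iterate_transferApply β hΦ s
  have hA : l2 (G i * slabGround (L := N) β M) ((transferApply β)^[2 * s] (G i * slabGround β M)) = l2 a a := by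
    rw [← hss, ← l2_iterate_polar β hGΦ hGΦ s s]
  have hB : l2 (G i * slabGround (L := N) β M) ((transferApply β)^[2 * s] (slabGround β M)) = l2 a b := by
    rw [← hss, ← l2_iterate_polar β hGΦ hΦ s s]
  have hC : l2 (slabGround (L := N) β M) ((transferApply β)^[2 * s] (G i * slabGround β M)) = l2 a b := by
    rw [← hss, ← l2_iterate_polar β hΦ hGΦ s s, l2_comm]
  have hD : l2 (slabGround (L := N) β M) ((transferApply β)^[2 * s] (slabGround β M)) = l2 b b := by
    rw [← hss, ← l2_iterate_polar β hΦ hΦ s s]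
  simp only [slabTrunc, slabRatio, h1Φ, hA, hB, hC, hD]
  have hcs : l2 a b ^ 2 ≤ l2 a a * l2 b b := sq_l2_le haP hbP
  have hbb : 0 ≤ l2 b b := l2_self_nonneg _
  rcases hbb.eq_or_lt with h0 | hpos
  · rw [← h0]; simp
  · rw [div_mul_div_comm, sub_nonneg, div_le_div_iff₀ (mul_pos hpos hpos) hpos]
    nlinarith [l2_self_nonneg a]

end Sign

end Summit.QuantumFields.YangMills.Theorems.FemtoTransferGap.PolyakovLift.Negative
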